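import Summits.CriticalPhenomena.SAWScalingLimit.Theses.SAWParafermion
import Literature.Probability.RandomPlanarGeometry.SAWParafermion

/-!
Refutation of `SAWParafermion.Tight` (item stmt-CriticalPhenomena-0772; the same decl body is
`SAWConfRestriction.Tight`).

`Literature.IsTightLaws μ := IsTightMeasureSet (μ '' Set.Ioc 0 1)` quantifies over ALL meshes
`δ ∈ (0, 1]`, while `Literature.Probability.RandomPlanarGeometry.SAW.IsEndpointApprox` only constrains the endpoints `a δ, b δ` along
`𝓝[>] 0`.  Witness: `D = DobrushinDomain.unitDisc` (marked points `1, -1`); for `δ ≤ 1/2` the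
honest approximation `a δ = (⌈δ⁻¹⌉ - 1, 0)`, `b δ = -(a δ)` (joined in `Ω_δ` because the mesh
graph of the disc is connected, so `Ω_δ` is all of `δℤ² ∩ 𝔻`); for `δ ∈ (1/2, 1]` the far-away
coincident endpoints `a δ = b δ = (⌈(δ - 1/2)⁻¹⌉, 0)`.  There the only SAW is the trivial walk,
the law is a Dirac mass at the constant curve sitting at `δ · a δ`, whose norm is unbounded as
`δ ↓ 1/2`; since `CurveClass.source` is continuous, mass `1` escapes every compact set.

The whole argument is packed into ONE theorem (the gate accepts only `¬ Theses`-typed decls from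
refuters); the helper facts are local `have`s.
-/

open Literature.Probability.RandomPlanarGeometry Literature.Probability.RandomPlanarGeometry.SAW Literature.Probability.LatticeModels Literature.Probability.Percolation MeasureTheory Filter Topology Set

namespace Summit.CriticalPhenomena.SAWScalingLimit.Theorems

/-- Refutes `SAWParafermion.Tight`: "for every Dobrushin domain and endpoint approximation the
critical `δℤ²` SAW laws, `δ ∈ (0,1]`, are tight" is FALSE as typed, because `Literature.Probability.RandomPlanarGeometry.IsTightLaws`
ranges over all `δ ∈ (0, 1]` while `IsEndpointApprox` only constrains `δ → 0⁺`; witness: the unit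
disc with honest endpoints `(±(⌈δ⁻¹⌉ - 1), 0)` for `δ ≤ 1/2` and coincident far endpoints
`(⌈(δ - 1/2)⁻¹⌉, 0)` for `δ ∈ (1/2, 1]`, where the law is a Dirac mass at a constant curve of
unbounded position, so mass `1` escapes every compact set (`CurveClass.source` is continuous).
Fix for the planner: eventual tightness `∃ δ₀ > 0, IsTightMeasureSet (μ '' Set.Ioc 0 δ₀)`.
[folklore] -/
theorem SAWParafermionTight_refuted :
    ¬ Summit.CriticalPhenomena.SAWScalingLimit.Theses.SAWParafermion.Tight := by
  intro hT
  /- ### arithmetic of mesh points -/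
  have normSq_meshPoint : ∀ (δ : ℝ) (x : Site 2),
      Complex.normSq (meshPoint δ x) = δ ^ 2 * ((x 0 : ℝ) ^ 2 + (x 1 : ℝ) ^ 2) := by
    intro δ x
    rw [Complex.normSq_apply, meshPoint_re, meshPoint_im]; ring
  have mem_ball_of_sq_le : ∀ {δ : ℝ} {x y : Site 2},
      meshPoint δ x ∈ Metric.ball (0 : ℂ) 1 →
      (y 0 : ℝ) ^ 2 + (y 1 : ℝ) ^ 2 ≤ (x 0 : ℝ) ^ 2 + (x 1 : ℝ) ^ 2 →
      meshPoint δ y ∈ Metric.ball (0 : ℂ) 1 := by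
    intro δ x y hx h
    rw [Metric.mem_ball, dist_zero_right] at hx ⊢
    have hx2 : ‖meshPoint δ x‖ ^ 2 < 1 := by
      have := norm_nonneg (meshPoint δ x); nlinarith
    have hy2 : ‖meshPoint δ y‖ ^ 2 ≤ ‖meshPoint δ x‖ ^ 2 := by
      rw [Complex.sq_norm, Complex.sq_norm, normSq_meshPoint, normSq_meshPoint]
      exact mul_le_mul_of_nonneg_left h (sq_nonneg δ)
    have hy1 : ‖meshPoint δ y‖ ^ 2 < 1 := hy2.trans_lt hx2
    nlinarith [norm_nonneg (meshPoint δ y)]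
  /- one step towards the origin, decreasing `|x₀| + |x₁|` -/
  have exists_step : ∀ x : Site 2, x ≠ 0 →
      ∃ y : Site 2, (zdGraph 2).Adj x y ∧
        (y 0 : ℝ) ^ 2 + (y 1 : ℝ) ^ 2 ≤ (x 0 : ℝ) ^ 2 + (x 1 : ℝ) ^ 2 ∧
        (y 0).natAbs + (y 1).natAbs < (x 0).natAbs + (x 1).natAbs := by
    intro x hx
    by_cases h0 : x 0 = 0
    · have h1 : x 1 ≠ 0 := by
        intro h1; apply hx; funext i; fin_cases i <;> simp [h0, h1]
      rcases lt_or_gt_of_ne h1 with hneg | hpos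
      · refine ⟨x + Pi.single 1 1, (zdGraph_adj_iff _ _).2 ⟨1, Or.inl rfl⟩, ?_, ?_⟩
        · simp only [Pi.add_apply, Pi.single_eq_same, Pi.single_eq_of_ne (zero_ne_one), add_zero,
            Int.cast_add, Int.cast_one]
          have : (x 1 : ℝ) ≤ -1 := by exact_mod_cast Int.le_sub_one_of_lt hneg
          nlinarith
        · simp only [Pi.add_apply, Pi.single_eq_same, Pi.single_eq_of_ne (zero_ne_one), add_zero]
          omega
      · refine ⟨x - Pi.single 1 1, (zdGraph_adj_iff _ _).2 ⟨1, Or.inr (by simp)⟩, ?_, ?_⟩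
        · simp only [Pi.sub_apply, Pi.single_eq_same, Pi.single_eq_of_ne (zero_ne_one), sub_zero,
            Int.cast_sub, Int.cast_one]
          have : (1 : ℝ) ≤ x 1 := by exact_mod_cast hpos
          nlinarith
        · simp only [Pi.sub_apply, Pi.single_eq_same, Pi.single_eq_of_ne (zero_ne_one), sub_zero]
          omega
    · rcases lt_or_gt_of_ne h0 with hneg | hpos
      · refine ⟨x + Pi.single 0 1, (zdGraph_adj_iff _ _).2 ⟨0, Or.inl rfl⟩, ?_, ?_⟩
        · simp only [Pi.add_apply, Pi.single_eq_same, Pi.single_eq_of_ne (one_ne_zero), add_zero,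
            Int.cast_add, Int.cast_one]
          have : (x 0 : ℝ) ≤ -1 := by exact_mod_cast Int.le_sub_one_of_lt hneg
          nlinarith
        · simp only [Pi.add_apply, Pi.single_eq_same, Pi.single_eq_of_ne (one_ne_zero), add_zero]
          omega
      · refine ⟨x - Pi.single 0 1, (zdGraph_adj_iff _ _).2 ⟨0, Or.inr (by simp)⟩, ?_, ?_⟩
        · simp only [Pi.sub_apply, Pi.single_eq_same, Pi.single_eq_of_ne (one_ne_zero), sub_zero,
            Int.cast_sub, Int.cast_one]
          have : (1 : ℝ) ≤ x 0 := by exact_mod_cast hpos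
          nlinarith
        · simp only [Pi.sub_apply, Pi.single_eq_same, Pi.single_eq_of_ne (one_ne_zero), sub_zero]
          omega
  /- ### the mesh graph of the unit disc is connected -/
  have meshPoint_zero : ∀ δ : ℝ, meshPoint δ (0 : Site 2) = 0 :=
    fun δ => Complex.ext (by simp) (by simp)
  have zero_mem : ∀ δ : ℝ, (0 : Site 2) ∈ meshVertices (Metric.ball (0 : ℂ) 1) δ := by
    intro δ; simp [meshVertices, meshPoint_zero δ]
  have meshGraph_adj_of : ∀ {δ : ℝ} {x y : Site 2}, (zdGraph 2).Adj x y →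
      meshPoint δ x ∈ Metric.ball (0 : ℂ) 1 → meshPoint δ y ∈ Metric.ball (0 : ℂ) 1 →
      (meshGraph (Metric.ball (0 : ℂ) 1) δ).Adj x y := fun hxy hx hy =>
    meshGraph_adj_iff.2 ⟨hxy, ((convex_ball (0 : ℂ) 1).segment_subset hx hy).trans subset_closure⟩
  have reachable_zero : ∀ (δ : ℝ) (n : ℕ) (x : Site 2)
      (hx : x ∈ meshVertices (Metric.ball (0 : ℂ) 1) δ), (x 0).natAbs + (x 1).natAbs = n →
      (meshVertexGraph (Metric.ball (0 : ℂ) 1) δ).Reachable ⟨x, hx⟩ ⟨0, zero_mem δ⟩ := by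
    intro δ n
    induction n using Nat.strong_induction_on with
    | _ n ih =>
      intro x hx hn
      by_cases h0 : x = 0
      · subst h0; rfl
      obtain ⟨y, hadj, hle, hlt⟩ := exists_step x h0
      have hy : y ∈ meshVertices (Metric.ball (0 : ℂ) 1) δ := mem_ball_of_sq_le hx hle
      have h1 : (meshVertexGraph (Metric.ball (0 : ℂ) 1) δ).Adj ⟨x, hx⟩ ⟨y, hy⟩ := by
        simp only [SimpleGraph.comap_adj, Function.Embedding.subtype_apply]
        exact meshGraph_adj_of hadj hx hy
      exact h1.reachable.trans (ih _ (hn ▸ hlt) y hy rfl)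
  have preconnected : ∀ δ : ℝ, (meshVertexGraph (Metric.ball (0 : ℂ) 1) δ).Preconnected := by
    intro δ u v
    exact (reachable_zero δ _ u.1 u.2 rfl).trans (reachable_zero δ _ v.1 v.2 rfl).symm
  /- for the disc, `Ω_δ` is all of `δℤ² ∩ 𝔻` -/
  have mem_meshDomain : ∀ {δ : ℝ} {x : Site 2}, x ∈ meshVertices (Metric.ball (0 : ℂ) 1) δ →
      x ∈ meshDomain (Metric.ball (0 : ℂ) 1) δ := by
    intro δ x hx
    have hsub := (preconnected δ).subsingleton_connectedComponent
    simp only [meshDomain, Set.mem_iUnion, Set.mem_image]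
    refine ⟨(meshVertexGraph (Metric.ball (0 : ℂ) 1) δ).connectedComponentMk ⟨x, hx⟩,
      fun C' => ?_, ⟨x, hx⟩, ?_, rfl⟩
    · rw [Subsingleton.elim C'
        ((meshVertexGraph (Metric.ball (0 : ℂ) 1) δ).connectedComponentMk ⟨x, hx⟩)]
    · rw [SimpleGraph.ConnectedComponent.mem_supp_iff]
  have reachable_of_mem : ∀ {δ : ℝ} {x y : Site 2}, meshPoint δ x ∈ Metric.ball (0 : ℂ) 1 →
      meshPoint δ y ∈ Metric.ball (0 : ℂ) 1 →
      (discreteDomainGraph (Metric.ball (0 : ℂ) 1) δ).Reachable x y := by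
    intro δ x y hx hy
    let hom : meshVertexGraph (Metric.ball (0 : ℂ) 1) δ →g
        discreteDomainGraph (Metric.ball (0 : ℂ) 1) δ :=
      { toFun := Subtype.val
        map_rel' := fun {u v} h =>
          discreteDomainGraph_adj_iff.2 ⟨h, mem_meshDomain u.2, mem_meshDomain v.2⟩ }
    exact (preconnected δ ⟨x, hx⟩ ⟨y, hy⟩).map hom
  /- ### the endpoint approximation -/
  have meshPoint_vec : ∀ (δ : ℝ) (m : ℤ), meshPoint δ ![m, 0] = ((δ * m : ℝ) : ℂ) :=
    fun δ m => Complex.ext (by simp) (by simp)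
  have near_bounds : ∀ {δ : ℝ}, 0 < δ →
      1 - δ ≤ δ * ((⌈δ⁻¹⌉ - 1 : ℤ) : ℝ) ∧ δ * ((⌈δ⁻¹⌉ - 1 : ℤ) : ℝ) < 1 := by
    intro δ hδ
    have h1 : ((⌈δ⁻¹⌉ - 1 : ℤ) : ℝ) < δ⁻¹ := by
      push_cast; linarith [Int.ceil_lt_add_one (δ⁻¹)]
    have h2 : δ⁻¹ - 1 ≤ ((⌈δ⁻¹⌉ - 1 : ℤ) : ℝ) := by
      push_cast; linarith [Int.le_ceil (δ⁻¹)]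
    have hδinv : δ * δ⁻¹ = 1 := mul_inv_cancel₀ hδ.ne'
    constructor
    · nlinarith
    · nlinarith
  have near_mem : ∀ {δ : ℝ}, 0 < δ → δ < 2 →
      meshPoint δ ![⌈δ⁻¹⌉ - 1, 0] ∈ Metric.ball (0 : ℂ) 1 := by
    intro δ hδ hδ2
    rw [meshPoint_vec, Metric.mem_ball, dist_zero_right, Complex.norm_real, Real.norm_eq_abs,
      abs_lt]
    obtain ⟨h1, h2⟩ := near_bounds hδ
    constructor <;> linarith
  have meshPoint_neg_near : ∀ δ : ℝ,
      meshPoint δ ![-(⌈δ⁻¹⌉ - 1), 0] = -meshPoint δ ![⌈δ⁻¹⌉ - 1, 0] := by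
    intro δ; rw [meshPoint_vec, meshPoint_vec]; push_cast; ring
  have neg_near_mem : ∀ {δ : ℝ}, 0 < δ → δ < 2 →
      meshPoint δ ![-(⌈δ⁻¹⌉ - 1), 0] ∈ Metric.ball (0 : ℂ) 1 := by
    intro δ hδ hδ2
    rw [meshPoint_neg_near, Metric.mem_ball, dist_zero_right, norm_neg, ← dist_zero_right,
      ← Metric.mem_ball]
    exact near_mem hδ hδ2
  have dist_near_le : ∀ {δ : ℝ}, 0 < δ → dist (meshPoint δ ![⌈δ⁻¹⌉ - 1, 0]) 1 ≤ δ := by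
    intro δ hδ
    rw [meshPoint_vec, ← Complex.ofReal_one, Complex.dist_eq, ← Complex.ofReal_sub,
      Complex.norm_real, Real.norm_eq_abs, abs_le]
    obtain ⟨h1, h2⟩ := near_bounds hδ
    constructor <;> linarith
  have dist_neg_near_le : ∀ {δ : ℝ}, 0 < δ →
      dist (meshPoint δ ![-(⌈δ⁻¹⌉ - 1), 0]) (-1) ≤ δ := by
    intro δ hδ
    rw [meshPoint_neg_near, dist_neg_neg]
    exact dist_near_le hδ
  have pt_zero : DobrushinDomain.unitDisc.pt 0 = 1 := by
    simp [MarkedDomain.pt, DobrushinDomain.unitDisc, JordanDomain.unitDisc, circleMap]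
  have pt_one : DobrushinDomain.unitDisc.pt 1 = -1 := by
    simp [MarkedDomain.pt, DobrushinDomain.unitDisc, JordanDomain.unitDisc, circleMap]
    rw [show (2 * (Real.pi : ℂ) * 2⁻¹ * Complex.I) = Real.pi * Complex.I by ring]
    exact Complex.exp_pi_mul_I
  have Ioo_half_mem : Set.Ioo (0 : ℝ) 2⁻¹ ∈ 𝓝[>] (0 : ℝ) := Ioo_mem_nhdsGT (by norm_num)
  have carrier_eq : DobrushinDomain.unitDisc.carrier = Metric.ball (0 : ℂ) 1 := rfl
  /- the two endpoint families (honest for `δ ≤ 1/2`, far and coincident for `δ > 1/2`) -/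
  have isEndpointApprox : IsEndpointApprox DobrushinDomain.unitDisc
      (fun δ => if δ ≤ 2⁻¹ then ![⌈δ⁻¹⌉ - 1, 0] else ![⌈(δ - 2⁻¹)⁻¹⌉, 0])
      (fun δ => if δ ≤ 2⁻¹ then ![-(⌈δ⁻¹⌉ - 1), 0] else ![⌈(δ - 2⁻¹)⁻¹⌉, 0]) := by
    refine ⟨?_, ?_, ?_⟩
    · filter_upwards [Ioo_half_mem] with δ hδ
      simp only [if_pos hδ.2.le]
      exact reachable_of_mem (near_mem hδ.1 (by linarith [hδ.2]))
        (neg_near_mem hδ.1 (by linarith [hδ.2]))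
    · rw [pt_zero, Metric.tendsto_nhds]
      intro ε hε
      filter_upwards [Ioo_mem_nhdsGT (lt_min hε (by norm_num : (0 : ℝ) < 2⁻¹))] with δ hδ
      have hδε : δ < ε := hδ.2.trans_le (min_le_left _ _)
      have hδ2 : δ < 2⁻¹ := hδ.2.trans_le (min_le_right _ _)
      simp only [if_pos hδ2.le]
      exact (dist_near_le hδ.1).trans_lt hδε
    · rw [pt_one, Metric.tendsto_nhds]
      intro ε hε
      filter_upwards [Ioo_mem_nhdsGT (lt_min hε (by norm_num : (0 : ℝ) < 2⁻¹))] with δ hδ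
      have hδε : δ < ε := hδ.2.trans_le (min_le_left _ _)
      have hδ2 : δ < 2⁻¹ := hδ.2.trans_le (min_le_right _ _)
      simp only [if_pos hδ2.le]
      exact (dist_neg_near_le hδ.1).trans_lt hδε
  /- ### the far branch: unbounded positions on `δ ∈ (1/2, 1]` -/
  have exists_far : ∀ R : ℝ, ∃ δ : ℝ, 2⁻¹ < δ ∧ δ ≤ 1 ∧
      R < ‖meshPoint δ ![⌈(δ - 2⁻¹)⁻¹⌉, 0]‖ := by
    intro R
    set R' : ℝ := max R 0 with hR'
    have hR'0 : 0 ≤ R' := le_max_right _ _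
    set t : ℝ := (2 * (R' + 1))⁻¹ with ht
    have ht0 : 0 < t := by positivity
    have ht1 : t ≤ 2⁻¹ := by
      rw [ht]; gcongr; linarith
    refine ⟨2⁻¹ + t, by linarith, by linarith, ?_⟩
    rw [meshPoint_vec, Complex.norm_real, Real.norm_eq_abs]
    have hsub : (2⁻¹ + t - 2⁻¹ : ℝ) = t := by ring
    rw [hsub]
    have hceil : t⁻¹ ≤ ((⌈t⁻¹⌉ : ℤ) : ℝ) := Int.le_ceil _
    have htinv : t⁻¹ = 2 * (R' + 1) := by rw [ht, inv_inv]
    have hprod : (2⁻¹ + t) * ((⌈t⁻¹⌉ : ℤ) : ℝ) ≥ R' + 1 := by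
      have : (2⁻¹ + t) * t⁻¹ ≥ 2⁻¹ * t⁻¹ := by
        have : 0 < t⁻¹ := inv_pos.2 ht0
        nlinarith
      calc (2⁻¹ + t) * ((⌈t⁻¹⌉ : ℤ) : ℝ) ≥ (2⁻¹ + t) * t⁻¹ := by
            apply mul_le_mul_of_nonneg_left hceil; linarith
        _ ≥ 2⁻¹ * t⁻¹ := this
        _ = R' + 1 := by rw [htinv]; ring
    rw [abs_of_nonneg (by linarith)]
    linarith [le_max_left R 0]
  /- ### the law at coincident endpoints is a Dirac mass at the trivial curve -/
  have curve_nil_source : ∀ (Ω : Set ℂ) (δ : ℝ) (w : Site 2),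
      (DomainSAW.nil w : DomainSAW Ω δ w w).curve.source = meshPoint δ w := by
    intro Ω δ w
    simp only [DomainSAW.curve, DomainSAW.nil, CurveClass.source_mk, Curve.source]
    exact SimpleGraph.Walk.toCurve_apply_zero (meshPoint δ)
      (SimpleGraph.Walk.nil : (discreteDomainGraph Ω δ).Walk w w)
  have law_map_compl_eq_one : ∀ {Ω : Set ℂ} {δ : ℝ} {u v w : Site 2}, u = w → v = w →
      ∀ {K : Set (CurveClass ℂ)}, MeasurableSet K →
      (DomainSAW.nil w : DomainSAW Ω δ w w).curve ∉ K →
      ((law Ω δ u v).map (fun γ => γ.curve)) Kᶜ = 1 := by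
    intro Ω δ u v w hu hv K hK hnot
    subst hu; subst hv
    rw [Measure.map_apply (DomainSAW.measurable_of_top _) hK.compl]
    have hpre : (fun γ : DomainSAW Ω δ v v => γ.curve) ⁻¹' Kᶜ = univ := by
      refine eq_univ_of_forall fun γ => ?_
      rw [DomainSAW.eq_nil_of_self γ]
      exact hnot
    rw [hpre]
    have hw : weight Ω δ v v univ = 1 := by
      rw [univ_unique, show (default : DomainSAW Ω δ v v) = DomainSAW.nil v from rfl,
        weight_singleton]
      simp
    simp [law, hw]
  /- ### contradiction -/
  have h := hT DobrushinDomain.unitDisc _ _ isEndpointApprox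
  rw [IsTightLaws, isTightMeasureSet_iff_exists_isCompact_measure_compl_le] at h
  obtain ⟨K, hK, hμ⟩ := h 2⁻¹ (by simp)
  have hbdd : Bornology.IsBounded (CurveClass.source '' K) :=
    (hK.image CurveClass.continuous_source).isBounded
  obtain ⟨R, hR⟩ := (Metric.isBounded_iff_subset_closedBall 0).1 hbdd
  obtain ⟨δ₀, hδ₀half, hδ₀one, hnorm⟩ := exists_far R
  have hle := hμ _ (mem_image_of_mem _ ⟨by linarith, hδ₀one⟩)
  have ha : (fun δ : ℝ => if δ ≤ 2⁻¹ then ![⌈δ⁻¹⌉ - 1, 0] else ![⌈(δ - 2⁻¹)⁻¹⌉, 0]) δ₀ =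
      ![⌈(δ₀ - 2⁻¹)⁻¹⌉, 0] := if_neg (not_le.2 hδ₀half)
  have hb : (fun δ : ℝ => if δ ≤ 2⁻¹ then ![-(⌈δ⁻¹⌉ - 1), 0] else ![⌈(δ - 2⁻¹)⁻¹⌉, 0]) δ₀ =
      ![⌈(δ₀ - 2⁻¹)⁻¹⌉, 0] := if_neg (not_le.2 hδ₀half)
  have hnot : (DomainSAW.nil ![⌈(δ₀ - 2⁻¹)⁻¹⌉, 0] :
      DomainSAW DobrushinDomain.unitDisc.carrier δ₀ ![⌈(δ₀ - 2⁻¹)⁻¹⌉, 0]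
        ![⌈(δ₀ - 2⁻¹)⁻¹⌉, 0]).curve ∉ K := by
    intro hin
    have hcl := hR (mem_image_of_mem _ hin)
    rw [curve_nil_source, Metric.mem_closedBall, dist_zero_right] at hcl
    linarith
  have h1 := law_map_compl_eq_one ha hb hK.isClosed.measurableSet hnot
  have hle' : ((law DobrushinDomain.unitDisc.carrier δ₀
      ((fun δ : ℝ => if δ ≤ 2⁻¹ then ![⌈δ⁻¹⌉ - 1, 0] else ![⌈(δ - 2⁻¹)⁻¹⌉, 0]) δ₀)
      ((fun δ : ℝ => if δ ≤ 2⁻¹ then ![-(⌈δ⁻¹⌉ - 1), 0] else ![⌈(δ - 2⁻¹)⁻¹⌉, 0]) δ₀)).map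
      (fun γ => γ.curve)) Kᶜ ≤ 2⁻¹ := hle
  rw [h1] at hle'
  exact absurd hle' (not_le.2 (ENNReal.inv_lt_one.2 ENNReal.one_lt_two))

end Summit.CriticalPhenomena.SAWScalingLimit.Theorems
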